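import Summits.QuantumFields.YangMills.Theses.FemtoCutoffLadder
import Summits.QuantumFields.YangMills.Theorems.FemtoCutoffLadderDyadicNestedUpperDeficit
import HarnessLib

/-!
# `DyadicNestedUpper` ⟸ ONE renormalisation-group inequality on `M`-step deficits of a trial multiplier (by-name reduction)
# (crux stmt-QuantumFields-25766 of route `FemtoCutoffLadder`, LINE 1 of seat ym-idea-1 g4; rung R2b1 = RECORD-label femto gap; seat ym-line-sfw-p1 g10,
# `--supports stmt-QuantumFields-25766`)

With the `M`-step deficit bound of `…DyadicNestedUpperDeficit.lean` (`λ₀^M·Var_Ω(g) − D_M(g) ≤ λ₁^M·Var_Ω(g)` for every admissible trial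
multiplier `g` on the fine lattice, `M = 2^k` fine steps = one coarse step), the crux `DyadicNestedUpper`
(`λ₁(L')^{L'}·λ₀(L)^L ≤ e^{CΛ²}·λ₁(L)^L·λ₀(L')^{L'}`, `L = 2^k·L'`, i.e. `z(Λ, 2^kL') ≤ z(Λ, L') + CΛ²`) FOLLOWS from the single hypothesis

  (RG)  on every matched tower pair and for the fine positive normalised ground state `Ω`, SOME admissible fine multiplier `g` (intended: the
        pulled-back ratio `(φ₁'/φ₀') ∘ B_{2^k}` of the coarse top pair, `…Pullback.lean`, `…Dirichlet.lean §3`) has `Var_Ω(g) > 0`,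
        non-negative `M`-step trial value `A = λ₀(L)^M·Var − D_M(g)`, and
        `λ₁(L')^{L'} · (λ₀(L)^M·Var)^{L'} ≤ e^{CΛ²} · λ₀(L')^{L'} · A^{L'}`      — i.e. `(1 − q_c)^{L'} ≤ e^{CΛ²}(1 − q_f^{(M)})^{L'}` with the coarse
        excitation ratio `1 − q_c = λ₁'/λ₀'` and the fine `M`-step deficit quotient `q_f^{(M)} = D_M(g)/(λ₀(L)^M Var)`,

proved here BY NAME against the route decl (`dyadicNestedUpper_of_trialDeficitRG`): the deficit bound turns `A^{L'}` into `λ₁(L)^{L}·Var^{L'}` and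
`Var^{L'} > 0` cancels.  (RG) is the honest remaining content of 25766: the blocked `M`-step fine ground-state chain, tested on ONE coarse observable,
relaxes at most `e^{CΛ²/L'}` faster than the coarse one-step chain (Bałaban averaging in transfer form; the item's why-it-might-fail).

HONEST FRAMING: a CONDITIONAL reduction; (RG) is NOT proved; R2b1 is a RECORD rung — nothing here concerns infinite volume, the continuum, or the Clay
Yang–Mills mass gap.  No definitions, no named facts, no `sorry`.  [cite: ReedSimonIV1978, Thm. XIII.1] [cite: Balaban1985Averaging]
-/

set_option autoImplicit false

noncomputable section

open MeasureTheory Filter Topology Real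
open Literature.MathematicalPhysics.QuantumFieldTheory (GaugeConfig Site gaugeTransform)

namespace Summit.QuantumFields.YangMills.Theorems.FemtoCutoffLadder

open Summit.QuantumFields.YangMills.Theorems.FemtoTransferGap
open Summit.QuantumFields.YangMills.Theses.FemtoCutoffLadder

/-- ★★★ **`DyadicNestedUpper` from the trial-deficit RG inequality** (hypothesis (RG) of the module docstring, spelled out; conclusion = the route decl
`Theses.FemtoCutoffLadder.DyadicNestedUpper` BY NAME). [cite: ReedSimonIV1978, Thm. XIII.1] [cite: Balaban1985Averaging] -/
theorem dyadicNestedUpper_of_trialDeficitRG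
    (hRG : ∃ (C lam0 : ℝ) (L0 : ℕ), 0 < lam0 ∧ ∀ lam : ℝ, 0 < lam → lam ≤ lam0 →
      ∀ (k : ℕ) (L' : ℕ) [NeZero L'] (L : ℕ) [NeZero L], L0 ≤ L' → L = 2 ^ k * L' → ∀ β β' : ℝ,
        InFemtoWindow lam β L → InFemtoWindow lam β' L' → luscherLambda β L = luscherLambda β' L' →
        ∀ Ω : GaugeConfig 3 L SU2 → ℝ, IsPhys Ω → (∀ U, 0 < Ω U) → l2 Ω Ω = 1 → transferApply β Ω = topValue su2Rep L β • Ω →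
          ∃ g : GaugeConfig 3 L SU2 → ℝ, Measurable g ∧ (∃ Cg : ℝ, ∀ U, |g U| ≤ Cg) ∧
            (∀ (κ : Site 3 L → SU2) (U : GaugeConfig 3 L SU2), g (gaugeTransform κ U) = g U) ∧
            (∀ (j : Fin 3), ∀ z ∈ Subgroup.center SU2, ∀ U : GaugeConfig 3 L SU2, g (twist j z U) = g U) ∧
            0 < l2 (fun U => g U * Ω U) (fun U => g U * Ω U) - l2 (fun U => g U * Ω U) Ω ^ 2 ∧
            0 ≤ topValue su2Rep L β ^ (2 ^ k) * (l2 (fun U => g U * Ω U) (fun U => g U * Ω U) - l2 (fun U => g U * Ω U) Ω ^ 2) -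
                (topValue su2Rep L β ^ (2 ^ k) * l2 (fun U => g U * Ω U) (fun U => g U * Ω U) -
                  l2 (fun U => g U * Ω U) ((transferApply β)^[2 ^ k] (fun U => g U * Ω U))) ∧
            secondValue su2Rep L' β' ^ L' *
                (topValue su2Rep L β ^ (2 ^ k) * (l2 (fun U => g U * Ω U) (fun U => g U * Ω U) - l2 (fun U => g U * Ω U) Ω ^ 2)) ^ L' ≤
              Real.exp (C * luscherLambda β L ^ 2) * (topValue su2Rep L' β' ^ L' *
                (topValue su2Rep L β ^ (2 ^ k) * (l2 (fun U => g U * Ω U) (fun U => g U * Ω U) - l2 (fun U => g U * Ω U) Ω ^ 2) -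
                  (topValue su2Rep L β ^ (2 ^ k) * l2 (fun U => g U * Ω U) (fun U => g U * Ω U) -
                    l2 (fun U => g U * Ω U) ((transferApply β)^[2 ^ k] (fun U => g U * Ω U)))) ^ L')) :
    DyadicNestedUpper := by
  obtain ⟨C, lam0, L0, hlam0, hRG⟩ := hRG
  refine ⟨C, lam0, L0, hlam0, ?_⟩
  intro lam hlam hle k L' _ L _ hL0 hL β β' hW hW' hmatch
  have hβ : 0 < β := zero_lt_one.trans_le hW.1
  -- the fine ground state
  obtain ⟨Ω, θ, c, hΩ, hc, hcle, hn, heig, -, -, -⟩ := PhysL2.exists_groundState (L := L) β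
  have hpos : ∀ U, 0 < Ω U := fun U => hc.trans_le (hcle U)
  obtain ⟨g, hgm, ⟨Cg, hgb⟩, hgg, hgz, hVar, hA, hineq⟩ := hRG lam hlam hle k L' L hL0 hL β β' hW hW' hmatch Ω hΩ hpos hn heig
  -- names
  set lam₀ := topValue su2Rep L β with hlam₀
  set lam₁ := secondValue su2Rep L β with hlam₁
  set lam₀' := topValue su2Rep L' β' with hlam₀'
  set lam₁' := secondValue su2Rep L' β' with hlam₁'
  set V := l2 (fun U => g U * Ω U) (fun U => g U * Ω U) - l2 (fun U => g U * Ω U) Ω ^ 2 with hV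
  set D := lam₀ ^ (2 ^ k) * l2 (fun U => g U * Ω U) (fun U => g U * Ω U) -
    l2 (fun U => g U * Ω U) ((transferApply β)^[2 ^ k] (fun U => g U * Ω U)) with hD
  set A := lam₀ ^ (2 ^ k) * V - D with hAdef
  -- the `M`-step deficit bound: `A ≤ λ₁^M · V`
  have hdef : A ≤ lam₁ ^ (2 ^ k) * V :=
    Deficit.pow_secondValue_ge_deficit hβ hgm hgb hgg hgz hΩ hn heig (m := 2 ^ k) Nat.one_le_two_pow
  have hlam₁0 : 0 ≤ lam₁ := secondValue_su2Rep_nonneg L hβ.le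
  have hlam₀'0 : 0 ≤ lam₀' := (topValue_su2Rep_pos L' β').le
  have hVL : 0 < V ^ L' := pow_pos hVar L'
  -- `A^{L'} ≤ λ₁(L)^L · V^{L'}`
  have hApow : A ^ L' ≤ lam₁ ^ L * V ^ L' := by
    calc A ^ L' ≤ (lam₁ ^ (2 ^ k) * V) ^ L' := pow_le_pow_left₀ hA hdef L'
      _ = lam₁ ^ L * V ^ L' := by rw [mul_pow, ← pow_mul, hL]
  -- chain and cancel `V^{L'}`
  have key : lam₁' ^ L' * lam₀ ^ L * V ^ L' ≤ Real.exp (C * luscherLambda β L ^ 2) * (lam₁ ^ L * lam₀' ^ L') * V ^ L' := by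
    calc lam₁' ^ L' * lam₀ ^ L * V ^ L' = lam₁' ^ L' * (lam₀ ^ (2 ^ k) * V) ^ L' := by rw [mul_pow, ← pow_mul, hL]; ring
      _ ≤ Real.exp (C * luscherLambda β L ^ 2) * (lam₀' ^ L' * A ^ L') := hineq
      _ ≤ Real.exp (C * luscherLambda β L ^ 2) * (lam₀' ^ L' * (lam₁ ^ L * V ^ L')) :=
          mul_le_mul_of_nonneg_left (mul_le_mul_of_nonneg_left hApow (pow_nonneg hlam₀'0 _)) (Real.exp_pos _).le
      _ = Real.exp (C * luscherLambda β L ^ 2) * (lam₁ ^ L * lam₀' ^ L') * V ^ L' := by ring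
  exact le_of_mul_le_mul_right key hVL

end Summit.QuantumFields.YangMills.Theorems.FemtoCutoffLadder

end
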